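import Literature.NumberTheory.EllipticCurves.WeilPairingLevelDescent
import Literature.NumberTheory.GaloisRepresentations.AbsGaloisGroup
import HarnessLib

/-!
# Torsion Kummer classes ⊥ the level tower, LOCALLY: over any extension field `E/F` (e.g. a completion `F_v`) the local Kummer
# classes of `E(E)[k]` are orthogonal, under the descended Weil pairing restricted to `Γ_E`, to every class `[k]_* ỹ`, `ỹ ∈ H¹(E, E[kd])`
# (route `KatoDescentPotSupersingular` / `…Tame…`, crux M = stmt-BirchSwinnertonDyer-19196; route-free helper)

Seat `bsd-potss-rkm` g18 (prover; cell `bsd-potss`), item stmt-BirchSwinnertonDyer-19196 (`--supports … --as helper`; closes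
nothing).  HONEST FRAMING: BSD is not proved by any of this; nothing is booked; theorems only (no definition, no named fact):
TOOL theorems of local Galois cohomology of elliptic curves.

Sequel of `…KummerTowerOrthogonal` (the same statements over the base field `F`).  Brick (a) of crux M's level-0 ledger (memo
`HOME/rkm/FINDING-19196-rkm-g18.md`) needs the orthogonality AT THE PLACE `p`: the kernel of
`ι_* : H¹(ℚ_p, E[p^k]) → H¹(ℚ_p, E[p^{k+j}])` (the Kummer classes of `E(ℚ_p)[p^j]`) must be orthogonal to `loc_p red_{p^k}(A)
= [p^j]_* loc_p red_{p^{k+j}}(A)`.  In the tree's currency the local classes at an extension field `E` of `F` (`[Algebra F E]`, e.g.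
`E = F_v`) live in `H¹(Γ_E, E[n](F̄)|_{Γ_E})` (`GaloisRep.restrictField E (W.torsionGaloisModule n)`; local Kummer classes
`WeierstrassCurve.localKummerClass`), and the pairings are the tree's `DiscreteGaloisModule.pairing` on the RESTRICTED modules with
the same bilinear maps (`weilPairingHom` at level `kd`, its composite with `ι` = the mixed pairing, `descendHom` = the descended
pairing of `WeilPairingLevelDescent`), values in `μ_{kd}(F̄)|_{Γ_E}`.  This file proves, for every field `F` of characteristic `0`,
`W/F` elliptic, every extension field `E/F` of characteristic `0`, levels `d`, `kd` and a level-`kd` Weil datum `e`: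

* `cupProduct_weil_map_inclKD_restrictField`, `cupProduct_mix_eq_descend_restrictField`,
  **`cupProduct_weil_map_inclKD_eq_descend_restrictField`: `ι_* x ∪_{kd} ỹ = x ∪_desc [k]_* ỹ` on `H¹(Γ_E, ·)`** (the tree's
  `cupProduct_weil_map_inclKD_eq_descend` restricted to `Γ_E`: two adjoint naturalities of the cup product);
* `map_inclKD_restrictField_localKummerClass_eq_zero`: **`ι_* κ_{E,d}(Q) = 0`** for `Q ∈ E(Ē)` with `dQ ∈ E(E)` and `(kd)Q = 0`;
* **`cupProduct_descend_restrictField_localKummerClass_map_mulK_eq_zero`: `κ_{E,d}(Q) ∪_desc [k]_* ỹ = 0`** for all such `Q` and all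
  `ỹ ∈ H¹(Γ_E, E[kd])`, and the flipped form `[k]_* ỹ ∪'_desc κ_{E,d}(Q) = 0`.

References: J. S. Milne, *ADT* I §6, proof of Prop. 6.9 [MilneADT2006]; J. H. Silverman, *AEC* VIII §2, X §4, III.8.1 (e)
[SilvermanAEC2009]; Neukirch–Schmidt–Wingberg, *Cohomology of Number Fields* I §4 (1.4.2), (1.4.4) [NeukirchSchmidtWingberg2008];
K. Kato, Astérisque 295, proof of Prop. 14.16 [Kato2004Asterisque].
-/

-- the summit and its single problem are both named `BirchSwinnertonDyer` (registry layout D-0017)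
set_option linter.dupNamespace false
set_option autoImplicit false

noncomputable section

open scoped Classical ContRepresentation
open CategoryTheory Function Field WeierstrassCurve
open Literature.NumberTheory.GaloisRepresentations Literature.NumberTheory.EllipticCurves
open Literature.NumberTheory.GaloisRepresentations.DiscreteGaloisModule (mu MuCarrier pairing homOfIntertwining)

-- Cup products need `LocallyCompactSpace Γ_E`: in characteristic `0` the compactness of `Γ_E` is the tree's global instance
-- `Field.absoluteGaloisGroup.instCompactSpace` (`GaloisRepresentations/AbsGaloisGroup.lean`).

universe u

namespace Summit.BirchSwinnertonDyer.BirchSwinnertonDyer.Theorems.KummerTowerOrthogonal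

section Local

variable {F : Type u} [Field F] [CharZero F] (W : WeierstrassCurve F) (k d : ℕ) [NeZero k] [NeZero d]
  (E : Type u) [Field E] [Algebra F E] [CharZero E]
  (e : geomTorsion W ((k * d : ℕ) : ℤ) → geomTorsion W ((k * d : ℕ) : ℤ) → AlgebraicClosure F)
  (hμ : ∀ S T, e S T ^ (k * d) = 1)
  (hadd₁ : ∀ S₁ S₂ T, e (S₁ + S₂) T = e S₁ T * e S₂ T)
  (hadd₂ : ∀ S T₁ T₂, e S (T₁ + T₂) = e S T₁ * e S T₂)
  (hgal : ∀ (σ : absoluteGaloisGroup F) (S T : geomTorsion W ((k * d : ℕ) : ℤ)), σ • e S T = e (σ • S) (σ • T))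

/-! ### §1 The three pairings restricted to `Γ_E` and their cup-product identities -/

omit [CharZero F] in
/-- **`ι_* x ∪_{kd} ỹ = x ∪_mix ỹ` on `H¹(Γ_E, ·)`**: the level-`kd` Weil cup product (restricted to `Γ_E`) of a class pushed forward
from `H¹(Γ_E, E[d])` is the mixed cup product (adjoint naturality along `ι|_{Γ_E}`). [cite: NeukirchSchmidtWingberg2008, I §4 (1.4.2)]
[cite: MilneADT2006, Ch. I §6, proof of Prop. 6.9] -/
theorem cupProduct_weil_map_inclKD_restrictField
    (x : galoisCohomology (GaloisRep.restrictField E (W.torsionGaloisModule (d : ℤ))) 1)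
    (y : galoisCohomology (GaloisRep.restrictField E (W.torsionGaloisModule ((k * d : ℕ) : ℤ))) 1) :
    (pairing (GaloisRep.restrictField E (W.torsionGaloisModule ((k * d : ℕ) : ℤ)))
        (GaloisRep.restrictField E (W.torsionGaloisModule ((k * d : ℕ) : ℤ))) (GaloisRep.restrictField E (mu F (k * d)))
        (weilPairingHom W (k * d) e hμ hadd₁ hadd₂)
        (fun σ S T => (weilContPairing W (k * d) e hμ hadd₁ hadd₂ hgal).toLin_smul (absGaloisRestrict F E σ) S T)).cupProduct
        (galoisCohomology.map ((inclKD W k d).restrictField E) 1 x) y =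
      (pairing (GaloisRep.restrictField E (W.torsionGaloisModule (d : ℤ)))
        (GaloisRep.restrictField E (W.torsionGaloisModule ((k * d : ℕ) : ℤ))) (GaloisRep.restrictField E (mu F (k * d)))
        ((weilPairingHom W (k * d) e hμ hadd₁ hadd₂).comp (inclKD W k d).toContinuousLinearMap.toLinearMap.toAddMonoidHom)
        (fun σ S T => (weilContPairing W (k * d) e hμ hadd₁ hadd₂ hgal).toLin_smul (absGaloisRestrict F E σ)
          (inclKD W k d S) T)).cupProduct x y := by
  have h := ContPairing.cupProduct_adjoint
    (pairing (GaloisRep.restrictField E (W.torsionGaloisModule (d : ℤ)))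
      (GaloisRep.restrictField E (W.torsionGaloisModule ((k * d : ℕ) : ℤ))) (GaloisRep.restrictField E (mu F (k * d)))
      ((weilPairingHom W (k * d) e hμ hadd₁ hadd₂).comp (inclKD W k d).toContinuousLinearMap.toLinearMap.toAddMonoidHom)
      (fun σ S T => (weilContPairing W (k * d) e hμ hadd₁ hadd₂ hgal).toLin_smul (absGaloisRestrict F E σ)
        (inclKD W k d S) T))
    (pairing (GaloisRep.restrictField E (W.torsionGaloisModule ((k * d : ℕ) : ℤ)))
      (GaloisRep.restrictField E (W.torsionGaloisModule ((k * d : ℕ) : ℤ))) (GaloisRep.restrictField E (mu F (k * d)))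
      (weilPairingHom W (k * d) e hμ hadd₁ hadd₂)
      (fun σ S T => (weilContPairing W (k * d) e hμ hadd₁ hadd₂ hgal).toLin_smul (absGaloisRestrict F E σ) S T))
    (homOfIntertwining ((inclKD W k d).restrictField E)) (𝟙 _) (fun S T => rfl) x y
  have h1 : cohomologyMap (𝟙 (DiscreteGaloisModule.toTopRep
      (GaloisRep.restrictField E (W.torsionGaloisModule ((k * d : ℕ) : ℤ))))) 1 y = y := by
    rw [show cohomologyMap (𝟙 (DiscreteGaloisModule.toTopRep
        (GaloisRep.restrictField E (W.torsionGaloisModule ((k * d : ℕ) : ℤ))))) 1 = 𝟙 _ from map_id_eq_id _ (fun _ => rfl) 1]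
    rfl
  rw [h1] at h
  exact h

/-- **`x ∪_mix ỹ = x ∪_desc [k]_* ỹ` on `H¹(Γ_E, ·)`**: the mixed cup product only depends on `[k]_* ỹ`, through the descended pairing
(adjoint naturality along `[k]|_{Γ_E}` and `e_{kd}(ι S, T̃) = descendHom S (k T̃)`). [cite: NeukirchSchmidtWingberg2008, I §4 (1.4.2)]
[cite: SilvermanAEC2009, Prop. III.8.1 (e)] -/
theorem cupProduct_mix_eq_descend_restrictField
    (x : galoisCohomology (GaloisRep.restrictField E (W.torsionGaloisModule (d : ℤ))) 1)
    (y : galoisCohomology (GaloisRep.restrictField E (W.torsionGaloisModule ((k * d : ℕ) : ℤ))) 1) :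
    (pairing (GaloisRep.restrictField E (W.torsionGaloisModule (d : ℤ)))
        (GaloisRep.restrictField E (W.torsionGaloisModule ((k * d : ℕ) : ℤ))) (GaloisRep.restrictField E (mu F (k * d)))
        ((weilPairingHom W (k * d) e hμ hadd₁ hadd₂).comp (inclKD W k d).toContinuousLinearMap.toLinearMap.toAddMonoidHom)
        (fun σ S T => (weilContPairing W (k * d) e hμ hadd₁ hadd₂ hgal).toLin_smul (absGaloisRestrict F E σ)
          (inclKD W k d S) T)).cupProduct x y =
      (pairing (GaloisRep.restrictField E (W.torsionGaloisModule (d : ℤ))) (GaloisRep.restrictField E (W.torsionGaloisModule (d : ℤ)))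
        (GaloisRep.restrictField E (mu F (k * d))) (descendHom W k d e hμ hadd₁ hadd₂)
        (fun σ S T => descendHom_smul W k d e hμ hadd₁ hadd₂ hgal (absGaloisRestrict F E σ) S T)).cupProduct x
        (galoisCohomology.map ((mulK W k d).restrictField E) 1 y) := by
  have h := ContPairing.cupProduct_adjoint
    (pairing (GaloisRep.restrictField E (W.torsionGaloisModule (d : ℤ))) (GaloisRep.restrictField E (W.torsionGaloisModule (d : ℤ)))
      (GaloisRep.restrictField E (mu F (k * d))) (descendHom W k d e hμ hadd₁ hadd₂)
      (fun σ S T => descendHom_smul W k d e hμ hadd₁ hadd₂ hgal (absGaloisRestrict F E σ) S T))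
    (pairing (GaloisRep.restrictField E (W.torsionGaloisModule (d : ℤ)))
      (GaloisRep.restrictField E (W.torsionGaloisModule ((k * d : ℕ) : ℤ))) (GaloisRep.restrictField E (mu F (k * d)))
      ((weilPairingHom W (k * d) e hμ hadd₁ hadd₂).comp (inclKD W k d).toContinuousLinearMap.toLinearMap.toAddMonoidHom)
      (fun σ S T => (weilContPairing W (k * d) e hμ hadd₁ hadd₂ hgal).toLin_smul (absGaloisRestrict F E σ)
        (inclKD W k d S) T))
    (𝟙 _) (homOfIntertwining ((mulK W k d).restrictField E))
    (fun S T => (descendHom_apply_eq W k d e hμ hadd₁ hadd₂ S (mulK W k d T) T rfl).symm) x y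
  have h1 : cohomologyMap (𝟙 (DiscreteGaloisModule.toTopRep
      (GaloisRep.restrictField E (W.torsionGaloisModule (d : ℤ))))) 1 x = x := by
    rw [show cohomologyMap (𝟙 (DiscreteGaloisModule.toTopRep
        (GaloisRep.restrictField E (W.torsionGaloisModule (d : ℤ))))) 1 = 𝟙 _ from map_id_eq_id _ (fun _ => rfl) 1]
    rfl
  rw [h1] at h
  exact h

/-- **`ι_* x ∪_{kd} ỹ = x ∪_desc [k]_* ỹ` on `H¹(Γ_E, ·)`** — the tree's `cupProduct_weil_map_inclKD_eq_descend` restricted to the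
absolute Galois group of any extension field `E/F`. [cite: MilneADT2006, Ch. I §6, proof of Prop. 6.9]
[cite: NeukirchSchmidtWingberg2008, I §4 (1.4.2)] -/
theorem cupProduct_weil_map_inclKD_eq_descend_restrictField
    (x : galoisCohomology (GaloisRep.restrictField E (W.torsionGaloisModule (d : ℤ))) 1)
    (y : galoisCohomology (GaloisRep.restrictField E (W.torsionGaloisModule ((k * d : ℕ) : ℤ))) 1) :
    (pairing (GaloisRep.restrictField E (W.torsionGaloisModule ((k * d : ℕ) : ℤ)))
        (GaloisRep.restrictField E (W.torsionGaloisModule ((k * d : ℕ) : ℤ))) (GaloisRep.restrictField E (mu F (k * d)))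
        (weilPairingHom W (k * d) e hμ hadd₁ hadd₂)
        (fun σ S T => (weilContPairing W (k * d) e hμ hadd₁ hadd₂ hgal).toLin_smul (absGaloisRestrict F E σ) S T)).cupProduct
        (galoisCohomology.map ((inclKD W k d).restrictField E) 1 x) y =
      (pairing (GaloisRep.restrictField E (W.torsionGaloisModule (d : ℤ))) (GaloisRep.restrictField E (W.torsionGaloisModule (d : ℤ)))
        (GaloisRep.restrictField E (mu F (k * d))) (descendHom W k d e hμ hadd₁ hadd₂)
        (fun σ S T => descendHom_smul W k d e hμ hadd₁ hadd₂ hgal (absGaloisRestrict F E σ) S T)).cupProduct x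
        (galoisCohomology.map ((mulK W k d).restrictField E) 1 y) := by
  rw [cupProduct_weil_map_inclKD_restrictField W k d E e hμ hadd₁ hadd₂ hgal,
    cupProduct_mix_eq_descend_restrictField W k d E e hμ hadd₁ hadd₂ hgal]

/-! ### §2 Local torsion Kummer classes die up the tower and are orthogonal to `[k]_* H¹(Γ_E, E[kd])` -/

variable [W.IsElliptic]

omit [CharZero E] in
/-- **`ι_* κ_{E,d}(Q) = 0` in `H¹(Γ_E, E[kd])`** for a local point `Q ∈ E(Ē)` with `dQ ∈ E(E)` and `(kd)Q = 0` (`P = dQ ∈ E(E)[k]`):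
`ι_* κ_{E,d}(Q) = κ_{E,kd}(Q)` (tree `map_torsionInclusion_localKummerClass`) is the local Kummer class of a `kd`-torsion point.
[cite: SilvermanAEC2009, VIII §2 and X §4 (the local Kummer sequences)] [cite: MilneADT2006, Ch. I §6, proof of Prop. 6.9] -/
theorem map_inclKD_restrictField_localKummerClass_eq_zero (Q : localPoints W E)
    (hQ : (d : ℤ) • Q ∈ MulAction.fixedPoints (absoluteGaloisGroup E) (localPoints W E))
    (hkd : ((k * d : ℕ) : ℤ) • Q = 0) :
    galoisCohomology.map ((inclKD W k d).restrictField E) 1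
      (W.localKummerClass (d : ℤ) (Int.natCast_ne_zero.mpr (NeZero.ne d)) Q hQ) = 0 := by
  have hQ' : ((k * d : ℕ) : ℤ) • Q ∈ MulAction.fixedPoints (absoluteGaloisGroup E) (localPoints W E) := by
    rw [hkd]; exact fun σ => smul_zero σ
  rw [W.map_torsionInclusion_localKummerClass _ (Int.natCast_ne_zero.mpr (NeZero.ne d))
    (Int.natCast_ne_zero.mpr (NeZero.ne (k * d))) Q hQ hQ', localKummerClass_eq_zero_iff]
  exact ⟨Q, hkd, by rw [sub_self]; exact fun σ => smul_zero σ⟩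

/-- **Local torsion Kummer classes are orthogonal to everything coming down the tower**: for `Q ∈ E(Ē)` with `dQ ∈ E(E)[k]` and
every `ỹ ∈ H¹(Γ_E, E[kd])`, **`κ_{E,d}(Q) ∪_desc [k]_* ỹ = 0`** in `H²(Γ_E, μ_{kd})` (restricted descended pairing).  With `E = ℚ_p`,
`k = p^j`, `d = p^k`: the Kummer classes of `E(ℚ_p)[p^j]` — the kernel of `H¹(ℚ_p,E[p^k]) → H¹(ℚ_p,E[p^{k+j}])` — pair to zero with
every `[p^j]_* ỹ`, in particular with `loc_p red_{p^k}(a) = [p^j]_* loc_p red_{p^{k+j}}(a)` for `a ∈ H¹(ℚ, T_pE)`.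
[cite: MilneADT2006, Ch. I §6, proof of Prop. 6.9] [cite: Kato2004Asterisque, proof of Prop. 14.16 (pp. 244–245)] -/
theorem cupProduct_descend_restrictField_localKummerClass_map_mulK_eq_zero (Q : localPoints W E)
    (hQ : (d : ℤ) • Q ∈ MulAction.fixedPoints (absoluteGaloisGroup E) (localPoints W E))
    (hkd : ((k * d : ℕ) : ℤ) • Q = 0)
    (y : galoisCohomology (GaloisRep.restrictField E (W.torsionGaloisModule ((k * d : ℕ) : ℤ))) 1) :
    (pairing (GaloisRep.restrictField E (W.torsionGaloisModule (d : ℤ))) (GaloisRep.restrictField E (W.torsionGaloisModule (d : ℤ)))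
        (GaloisRep.restrictField E (mu F (k * d))) (descendHom W k d e hμ hadd₁ hadd₂)
        (fun σ S T => descendHom_smul W k d e hμ hadd₁ hadd₂ hgal (absGaloisRestrict F E σ) S T)).cupProduct
        (W.localKummerClass (d : ℤ) (Int.natCast_ne_zero.mpr (NeZero.ne d)) Q hQ)
        (galoisCohomology.map ((mulK W k d).restrictField E) 1 y) = 0 := by
  -- move the vanishing factor to the right (`a ∪ b = -(b ∪' a)`), where `map_zero` applies
  rw [← cupProduct_weil_map_inclKD_eq_descend_restrictField W k d E e hμ hadd₁ hadd₂ hgal, ContPairing.cupProduct_comm,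
    map_inclKD_restrictField_localKummerClass_eq_zero W k d E Q hQ hkd, neg_eq_zero]
  exact map_zero _

/-- **The flipped form: `[k]_* ỹ ∪'_desc κ_{E,d}(Q) = 0`** (graded commutativity in bidegree `(1,1)`).
[cite: NeukirchSchmidtWingberg2008, I §4 (1.4.4)] [cite: MilneADT2006, Ch. I §6, proof of Prop. 6.9] -/
theorem cupProduct_descend_restrictField_flip_map_mulK_localKummerClass_eq_zero (Q : localPoints W E)
    (hQ : (d : ℤ) • Q ∈ MulAction.fixedPoints (absoluteGaloisGroup E) (localPoints W E))
    (hkd : ((k * d : ℕ) : ℤ) • Q = 0)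
    (y : galoisCohomology (GaloisRep.restrictField E (W.torsionGaloisModule ((k * d : ℕ) : ℤ))) 1) :
    (pairing (GaloisRep.restrictField E (W.torsionGaloisModule (d : ℤ))) (GaloisRep.restrictField E (W.torsionGaloisModule (d : ℤ)))
        (GaloisRep.restrictField E (mu F (k * d))) (descendHom W k d e hμ hadd₁ hadd₂)
        (fun σ S T => descendHom_smul W k d e hμ hadd₁ hadd₂ hgal (absGaloisRestrict F E σ) S T)).flip.cupProduct
        (galoisCohomology.map ((mulK W k d).restrictField E) 1 y)
        (W.localKummerClass (d : ℤ) (Int.natCast_ne_zero.mpr (NeZero.ne d)) Q hQ) = 0 := by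
  have h := (pairing (GaloisRep.restrictField E (W.torsionGaloisModule (d : ℤ)))
    (GaloisRep.restrictField E (W.torsionGaloisModule (d : ℤ))) (GaloisRep.restrictField E (mu F (k * d)))
    (descendHom W k d e hμ hadd₁ hadd₂)
    (fun σ S T => descendHom_smul W k d e hμ hadd₁ hadd₂ hgal (absGaloisRestrict F E σ) S T)).cupProduct_comm
    (W.localKummerClass (d : ℤ) (Int.natCast_ne_zero.mpr (NeZero.ne d)) Q hQ) (galoisCohomology.map ((mulK W k d).restrictField E) 1 y)
  rw [cupProduct_descend_restrictField_localKummerClass_map_mulK_eq_zero W k d E e hμ hadd₁ hadd₂ hgal Q hQ hkd y, eq_comm,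
    neg_eq_zero] at h
  exact h

end Local

end Summit.BirchSwinnertonDyer.BirchSwinnertonDyer.Theorems.KummerTowerOrthogonal

end
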